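import Mathlib
import Summits.Ventures.DiscreteObjects.Mahler.CyclotomicIntegerProdBoundTwo
import Summits.Ventures.DiscreteObjects.Mahler.CyclotomicIntegerLehmerAll
import Summits.Ventures.DiscreteObjects.Mahler.DobrowolskiSeparation

/-!
# `2^{deg α} ≤ M(α)^6` for every cyclotomic integer: Lehmer for abelian integers with Amoroso–Dvornicich's 2-adic constant (venture `DiscreteObjects`, target L)

Cell `pub-namedobj`, seat `pub-namedobj-mahler-g28`. Framing: lottery ticket; floor = certified bounds/negative ranges.

F. Amoroso, R. Dvornicich, J. Number Theory 80 (2000), proof of Proposition 2 (the prime `2`; Lemma 3), assembled for ALL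
conductors `m` by strong induction (degenerate case: twist + explicit descent `CyclotomicIntegerDescent` + fibre transfer
`CyclotomicIntegerTwistFibre`, exactly as in `CyclotomicIntegerLehmerAll` for [cite: BombieriGubler2001, Theorem 4.4.9]):
**for every `m ≥ 1`, every primitive `m`-th root of unity `ζ ∈ ℂ` and every `g ∈ ℤ[X]` with `α = g(ζ) ≠ 0` not a root of
unity, `2^{deg α} ≤ M(α)^6`** (`cyclotomicInteger_lehmer_bound_two`), i.e. `h(α) ≥ (log 2)/6 = 0.1155…` — sharper than
the `log(5/2)/10 = 0.0916…` of `CyclotomicIntegerLehmerAll` (the published optimum of the method, `(log 5)/12 = 0.1341…`,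
needs A–D's archimedean Lemma 4 and is not reproduced).  Corollaries: `M(α) ≥ 2^{1/3} = 1.2599…` in degree `≥ 2`
(`two_le_measure_pow_three`); every such `α` has a conjugate of modulus `≥ 2^{1/6} = 1.1224…` (`exists_conjugate_norm_pow_six_ge_two`).
REPLICATION of the published method (with the trivial archimedean estimate); no new mathematics claimed.
-/

namespace Summit.Ventures.DiscreteObjects.Mahler

open Polynomial Finset

/-- **`2^{deg α} ≤ M(α)^6` for every nonzero non-torsion cyclotomic integer `α = g(ζ_m)`, every conductor `m`**
(`h(α) ≥ (log 2)/6 = 0.1155…`; Amoroso–Dvornicich's 2-adic method with the trivial archimedean estimate — their theorem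
has `(log 5)/12`; [cite: BombieriGubler2001, Theorem 4.4.9] has `log(5/2)/10 = 0.0916…`, `CyclotomicIntegerLehmerAll`). -/
theorem cyclotomicInteger_lehmer_bound_two {m : ℕ} (hm : 0 < m) (g : ℤ[X]) {ζ : ℂ} (hζ : IsPrimitiveRoot ζ m)
    (h0 : aeval ζ g ≠ 0) (hnu : ∀ k : ℕ, 0 < k → aeval ζ g ^ k ≠ 1) :
    (2 : ℝ) ^ (minpoly ℤ (aeval ζ g)).natDegree ≤ intMahlerMeasure (minpoly ℤ (aeval ζ g)) ^ 6 := by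
  obtain ⟨e, he0, hed, hprod⟩ := exists_prod_max_eq_measure_pow hm g hζ
  have hB := cyclotomicInteger_prod_bound_two m hm g ζ hζ h0 hnu
  set M := intMahlerMeasure (minpoly ℤ (aeval ζ g)) with hM
  set d := (minpoly ℤ (aeval ζ g)).natDegree with hd
  have hR : (M ^ e) ^ 6 = (M ^ 6) ^ e := by rw [← pow_mul, ← pow_mul, mul_comm]
  rw [hprod, ← hed, hR, mul_comm e d, pow_mul] at hB
  have hζint : IsIntegral ℤ ζ := hζ.isIntegral hm
  have hαint : IsIntegral ℤ (aeval ζ g) := by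
    have hmem : aeval ζ g ∈ Algebra.adjoin ℤ {ζ} := Polynomial.aeval_mem_adjoin_singleton ℤ ζ
    exact (mem_integralClosure_iff ℤ ℂ).1 (adjoin_le_integralClosure hζint hmem)
  have hM0 : 0 ≤ M := le_trans zero_le_one (one_le_intMahlerMeasure (minpoly.monic hαint).ne_zero)
  exact (pow_le_pow_iff_left₀ (by positivity) (by positivity) he0).1 hB

/-- In degree `≥ 2`: **`M(α)^3 ≥ 2`, i.e. `M(α) ≥ 2^{1/3} = 1.2599…`**, for every nonzero non-torsion cyclotomic integer. -/
theorem two_le_measure_pow_three {m : ℕ} (hm : 0 < m) (g : ℤ[X]) {ζ : ℂ} (hζ : IsPrimitiveRoot ζ m)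
    (h0 : aeval ζ g ≠ 0) (hnu : ∀ k : ℕ, 0 < k → aeval ζ g ^ k ≠ 1) (hd : 2 ≤ (minpoly ℤ (aeval ζ g)).natDegree) :
    (2 : ℝ) ≤ intMahlerMeasure (minpoly ℤ (aeval ζ g)) ^ 3 := by
  have hB := cyclotomicInteger_lehmer_bound_two hm g hζ h0 hnu
  have h1 : (2 : ℝ) ^ 2 ≤ (intMahlerMeasure (minpoly ℤ (aeval ζ g)) ^ 3) ^ 2 := by
    rw [← pow_mul]
    exact (pow_le_pow_right₀ (by norm_num) hd).trans hB
  have hζint : IsIntegral ℤ ζ := hζ.isIntegral hm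
  have hαint : IsIntegral ℤ (aeval ζ g) := by
    have hmem : aeval ζ g ∈ Algebra.adjoin ℤ {ζ} := Polynomial.aeval_mem_adjoin_singleton ℤ ζ
    exact (mem_integralClosure_iff ℤ ℂ).1 (adjoin_le_integralClosure hζint hmem)
  have hM0 : 0 ≤ intMahlerMeasure (minpoly ℤ (aeval ζ g)) :=
    le_trans zero_le_one (one_le_intMahlerMeasure (minpoly.monic hαint).ne_zero)
  exact (pow_le_pow_iff_left₀ (by norm_num) (by positivity) two_ne_zero).1 h1

/-- **A uniform house bound**: every nonzero non-torsion cyclotomic integer has a conjugate `β` with `|β|^6 ≥ 2`, i.e. house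
`≥ 2^{1/6} = 1.1224…`, uniformly in the degree. -/
theorem exists_conjugate_norm_pow_six_ge_two {m : ℕ} (hm : 0 < m) (g : ℤ[X]) {ζ : ℂ} (hζ : IsPrimitiveRoot ζ m)
    (h0 : aeval ζ g ≠ 0) (hnu : ∀ k : ℕ, 0 < k → aeval ζ g ^ k ≠ 1) :
    ∃ β ∈ ((minpoly ℤ (aeval ζ g)).map (Int.castRingHom ℂ)).roots, (2 : ℝ) ≤ ‖β‖ ^ 6 := by
  classical
  have hζint : IsIntegral ℤ ζ := hζ.isIntegral hm
  have hαint : IsIntegral ℤ (aeval ζ g) := by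
    have hmem : aeval ζ g ∈ Algebra.adjoin ℤ {ζ} := Polynomial.aeval_mem_adjoin_singleton ℤ ζ
    exact (mem_integralClosure_iff ℤ ℂ).1 (adjoin_le_integralClosure hζint hmem)
  set f : ℤ[X] := minpoly ℤ (aeval ζ g) with hf
  have hmon : f.Monic := minpoly.monic hαint
  have hB := cyclotomicInteger_lehmer_bound_two hm g hζ h0 hnu
  set d := f.natDegree with hd
  have hdpos : 0 < d := minpoly.natDegree_pos hαint
  have hM1 : 1 ≤ intMahlerMeasure f := one_le_intMahlerMeasure hmon.ne_zero
  have hM : 1 < intMahlerMeasure f := by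
    by_contra hle
    have hle' : intMahlerMeasure f ≤ 1 := le_of_not_gt hle
    have h1 : intMahlerMeasure f ^ 6 ≤ 1 := pow_le_one₀ (by linarith) hle'
    have h2 : (2 : ℝ) ≤ (2 : ℝ) ^ d := by
      calc (2 : ℝ) = 2 ^ 1 := (pow_one _).symm
        _ ≤ 2 ^ d := pow_le_pow_right₀ (by norm_num) hdpos
    have h3 : (2 : ℝ) ^ d ≤ intMahlerMeasure f ^ 6 := hB
    linarith
  obtain ⟨z, hz, hz1, hmax⟩ := exists_root_norm_gt_one hmon hM
  refine ⟨z, hz, ?_⟩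
  set RC := (f.map (Int.castRingHom ℂ)).roots with hRC
  have hcard : RC.card = d := by
    rw [hRC, splits_iff_card_roots.1 (IsAlgClosed.splits _),
      natDegree_map_eq_of_injective (Int.castRingHom ℂ).injective_int]
  have hMle : intMahlerMeasure f ≤ ‖z‖ ^ d := by
    have hMf : intMahlerMeasure f = (RC.map fun γ => max 1 ‖γ‖).prod := by
      unfold intMahlerMeasure
      rw [mahlerMeasure_eq_leadingCoeff_mul_prod_roots, (hmon.map (Int.castRingHom ℂ)).leadingCoeff, norm_one,
        one_mul]
    rw [hMf]
    calc (RC.map fun γ => max 1 ‖γ‖).prod ≤ (RC.map fun _ => ‖z‖).prod :=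
          Multiset.prod_map_le_prod_map₀ _ _ (fun γ _ => by positivity) (fun γ hγ => max_le hz1.le (hmax γ hγ))
      _ = ‖z‖ ^ d := by rw [Multiset.map_const', Multiset.prod_replicate, hcard]
  have hM0 : 0 ≤ intMahlerMeasure f := by linarith
  have h1 : (2 : ℝ) ^ d ≤ (‖z‖ ^ 6) ^ d := by
    calc (2 : ℝ) ^ d ≤ intMahlerMeasure f ^ 6 := hB
      _ ≤ (‖z‖ ^ d) ^ 6 := pow_le_pow_left₀ hM0 hMle 6
      _ = (‖z‖ ^ 6) ^ d := by rw [← pow_mul, ← pow_mul, mul_comm]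
  exact (pow_le_pow_iff_left₀ (by norm_num) (by positivity) hdpos.ne').1 h1

end Summit.Ventures.DiscreteObjects.Mahler
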